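import Literature.AlgebraicGeometry.Resolution.RankOneReductionProofs
import Mathlib.RingTheory.AlgebraicIndependent.Basic
import HarnessLib

/-!
# Relative local uniformization of a composite valuation over a RATIONAL RESIDUE SURFACE
# (Novacoski–Spivakovsky's composite step, one pair `O ≤ O₁`)

Support file for crux stmt-ResolutionOfSingularities-16087 (`ValuativeSmoothing`, route file
`Theses/IndSmooth.lean`), line `birth`, wave 4: the composite family. For fields `k ⊆ K` and
valuation rings `O ≤ O₁` of `K` (so `ν_O = ν₁ ∘ ν₂`, `ν₁ = ν_{O₁}`, `ν₂` the valuation of the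
residue field `κ(O₁)` with ring `O / 𝔪_{O₁}`), SUPPOSE
* `ν₁` admits relative local uniformization over `k` (`h₁ : RelLocalUniformization k K O₁`);
* the residue field of `O₁` is a rational function field in two variables over `k`, generated by
  the residues of two elements `x, y ∈ O`: no nonzero polynomial in `x, y` over `k` drops in
  `ν₁`-value (`hind`, i.e. the residues `x̄, ȳ` are algebraically independent over `k`) and every
  residue class of `O₁` is `ā / b̄` with `a, b ∈ k[x, y]`, `ν₁(b) = 0` (`hres`);
* every valuation ring `W ⊇ k` of every rational function field `k(x', y')` in two variables
  admits relative local uniformization over `k` (`hLU2`; Zariski 1939 / Abhyankar 1956, proved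
  in `IndSmoothValuativeSmoothingRelLURegularCentre.lean` and fed in by the caller).
THEN `O` admits relative local uniformization over `k`
(`relLU_of_le_of_purelyTranscendentalResidue`).

**Proof.** This is the assembly of Novacoski–Spivakovsky's proof of their Thm. 1.1 (§3.1) for
the single decomposition `ν = ν₁ ∘ ν₂`, exactly as in the tree's `NovacoskiSpivakovsky2014_holds`
but with the two inductive inputs replaced by `h₁` and `hLU2`. Given an affine model `R ⊆ O`,
enlarge it to `R' = R[x, y] ⊆ O`; Cor. 2.14 (`novacoskiSpivakovsky2014_cor214`, input `h₁`)
gives `A₁ ⊇ R'` in `O` regular at the centre of `ν₁`. For Cor. 2.17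
(`novacoskiSpivakovsky2014_cor217`) one needs a `ν₂`-uniformizing model above the residue ring
`φ(A₁) ⊆ κ`, `ι : κ → κ(O₁)` a subfield containing the residues of `A₁`: since `x, y ∈ A₁`, the
residues `x' = φ(x)`, `y' = φ(y)` lie in `κ`, they are algebraically independent over `k`
(`algebraicIndependent_residuePair`, from `hind`), and `ι` is onto (`residue_eq_residueChart`,
from `hres`: every residue is `ι (φ a / φ b)`), so `κ = k(x', y')` is a rational function field
in two variables (`exists_fraction_residueChart`) and `hLU2` uniformizes the restriction
`W = (O / 𝔪_{O₁}).comap ι` of `ν₂` on the model `φ(A₁)`. The final step of §3.1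
(`novacoskiSpivakovsky2014_step`) then produces the regular model above `R' ⊇ R`.

## Source

J. Novacoski, M. Spivakovsky, *Reduction of local uniformization to the rank one case*,
Valuation Theory in Interaction (Segovia–El Escorial 2011), EMS Ser. Congr. Rep. (2014)
404–431; arXiv:1204.4751v1: Cor. 2.14, Cor. 2.17, §3.1. [NovacoskiSpivakovsky2014]
-/

-- single-problem summit: the doubled namespace component is forced
set_option linter.dupNamespace false

namespace Summit.ResolutionOfSingularities.ResolutionOfSingularities.Theorems.ValuativeSmoothing

open IsLocalRing Literature.AlgebraicGeometry.Resolution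

section residueChart

variable {k K : Type} [Field k] [Field K] [Algebra k K]

/-- Naturality of polynomial evaluation under the inclusion of a subalgebra: the value in `K`
of `P(x, y)` computed inside `A ∋ x, y` is `P(x, y)`. [folklore] -/
theorem coe_aeval_pair (A : Subalgebra k K) {x y : K} (hx : x ∈ A) (hy : y ∈ A)
    (P : MvPolynomial (Fin 2) k) :
    ((MvPolynomial.aeval ![(⟨x, hx⟩ : A), ⟨y, hy⟩] P : A) : K)
      = MvPolynomial.aeval ![x, y] P := by
  have hf : (fun i => A.val (![(⟨x, hx⟩ : A), ⟨y, hy⟩] i)) = ![x, y] := by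
    funext i
    fin_cases i <;> rfl
  change A.val (MvPolynomial.aeval _ P) = _
  rw [MvPolynomial.comp_aeval_apply, hf]

/-- Naturality of polynomial evaluation under an algebra map: `φ (P(a, b)) = P(φ a, φ b)`.
[folklore] -/
theorem algHom_aeval_pair {κ : Type*} [CommRing κ] [Algebra k κ] (A : Subalgebra k K)
    (φ : A →ₐ[k] κ) (a b : A) (P : MvPolynomial (Fin 2) k) :
    φ (MvPolynomial.aeval ![a, b] P) = MvPolynomial.aeval ![φ a, φ b] P := by
  have hf : (fun i => φ (![a, b] i)) = ![φ a, φ b] := by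
    funext i
    fin_cases i <;> rfl
  rw [MvPolynomial.comp_aeval_apply, hf]

/-- An algebra map `φ : A → κ` sends (the copy inside `A` of) `k[x, y]` into `k[φ x, φ y]`.
[folklore] -/
theorem map_mem_adjoin_pair {κ : Type*} [CommRing κ] [Algebra k κ] (A : Subalgebra k K)
    (φ : A →ₐ[k] κ) {x y : K} (hx : x ∈ A) (hy : y ∈ A) (a : A)
    (ha : (a : K) ∈ Algebra.adjoin k ({x, y} : Set K)) :
    φ a ∈ Algebra.adjoin k ({φ ⟨x, hx⟩, φ ⟨y, hy⟩} : Set κ) := by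
  have h1 : Algebra.adjoin k ({x, y} : Set K)
      = (Algebra.adjoin k ({(⟨x, hx⟩ : A), ⟨y, hy⟩} : Set A)).map A.val := by
    rw [AlgHom.map_adjoin, Set.image_pair]
    rfl
  rw [h1, Subalgebra.mem_map] at ha
  obtain ⟨a', ha', haa'⟩ := ha
  obtain rfl : a' = a := Subtype.ext haa'
  rw [← Set.image_pair, ← AlgHom.map_adjoin, Subalgebra.mem_map]
  exact ⟨a', ha', rfl⟩

/-- **Algebraic independence of the residues.** For a model `A ⊆ O₁` with residue map
`φ : A → κ ⊆ κ(O₁)` (`ι ∘ φ = residue`) and `x, y ∈ A`: if no nonzero polynomial in `x, y`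
over `k` has positive `ν₁`-value, then the residues `φ x, φ y` are algebraically independent
over `k` (a polynomial relation `P(φ x, φ y) = 0` means `residue (P(x, y)) = 0`, i.e.
`ν₁(P(x, y)) > 0`). [folklore] -/
theorem algebraicIndependent_residuePair (O₁ : ValuationSubring K) (A : Subalgebra k K)
    (hAO₁ : A.toSubring ≤ O₁.toSubring) {κ : Type*} [Field κ] [Algebra k κ]
    (ι : κ →+* ResidueField O₁) (φ : A →ₐ[k] κ)
    (hφ : ∀ a : A, ι (φ a) = residue O₁ ⟨(a : K), hAO₁ a.2⟩)
    {x y : K} (hx : x ∈ A) (hy : y ∈ A)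
    (hind : ∀ P : MvPolynomial (Fin 2) k, P ≠ 0 →
      O₁.valuation (MvPolynomial.aeval ![x, y] P) = 1) :
    AlgebraicIndependent k ![φ ⟨x, hx⟩, φ ⟨y, hy⟩] := by
  rw [algebraicIndependent_iff]
  intro P hP
  by_contra hP0
  have h1 := hind P hP0
  have h2 : ι (φ (MvPolynomial.aeval ![(⟨x, hx⟩ : A), ⟨y, hy⟩] P)) = 0 := by
    rw [algHom_aeval_pair, hP, map_zero]
  rw [hφ, residue_eq_zero_iff, ValuationSubring.valuation_lt_one_iff] at h2
  have h3 : O₁.valuation (MvPolynomial.aeval ![x, y] P) < 1 := by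
    rw [← coe_aeval_pair A hx hy P]
    exact h2
  exact (ne_of_lt h3) h1

/-- **Every residue is a fraction of residues of `k[x, y]`.** For `O ≤ O₁`, a model `A ⊆ O`
containing `k[x, y]` with residue map `φ : A → κ ⊆ κ(O₁)` (`ι ∘ φ = residue`): if every residue
class of `O₁` is `ā / b̄` with `a, b ∈ k[x, y]`, `ν₁(b) = 0` (hypothesis `hres`, stated in `K`:
`ν₁(z - a / b) > 0`), then every residue `z̄`, `z ∈ O₁`, equals `ι (φ a / φ b)` for such `a, b`,
with `φ b ≠ 0`. [folklore] -/
theorem residue_eq_residueChart (O O₁ : ValuationSubring K) (hO : O ≤ O₁) (A : Subalgebra k K)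
    (hA : A.toSubring ≤ O.toSubring) {κ : Type*} [Field κ] [Algebra k κ]
    (ι : κ →+* ResidueField O₁) (φ : A →ₐ[k] κ)
    (hφ : ∀ a : A, ι (φ a) = residue O₁ ⟨(a : K), (hA.trans hO) a.2⟩)
    {x y : K} (hadj : Algebra.adjoin k ({x, y} : Set K) ≤ A)
    (hres : ∀ z ∈ O₁, ∃ a ∈ Algebra.adjoin k ({x, y} : Set K),
      ∃ b ∈ Algebra.adjoin k ({x, y} : Set K),
      O₁.valuation b = 1 ∧ O₁.valuation (z - a / b) < 1) (z : O₁) :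
    ∃ a b : A, (a : K) ∈ Algebra.adjoin k ({x, y} : Set K) ∧
      (b : K) ∈ Algebra.adjoin k ({x, y} : Set K) ∧ φ b ≠ 0 ∧
      residue O₁ z = ι (φ a / φ b) := by
  obtain ⟨a, ha, b, hb, hb1, hz⟩ := hres z z.2
  have hAO₁ : A.toSubring ≤ O₁.toSubring := hA.trans hO
  have haA : a ∈ A := hadj ha
  have hbA : b ∈ A := hadj hb
  have haO₁ : a ∈ O₁ := hAO₁ haA
  have hbO₁ : b ∈ O₁ := hAO₁ hbA
  have hbi : b⁻¹ ∈ O₁ := inv_mem_of_valuation_eq_one O₁ hb1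
  have hab : a / b ∈ O₁ := by
    rw [div_eq_mul_inv]
    exact mul_mem haO₁ hbi
  have hresb : residue O₁ ⟨b, hbO₁⟩ ≠ 0 := by
    rw [ne_eq, residue_eq_zero_iff, ValuationSubring.valuation_lt_one_iff]
    change ¬ O₁.valuation b < 1
    rw [hb1]
    exact lt_irrefl 1
  refine ⟨⟨a, haA⟩, ⟨b, hbA⟩, ha, hb, ?_, ?_⟩
  · intro h0
    apply hresb
    rw [← hφ ⟨b, hbA⟩, h0, map_zero]
  · rw [map_div₀, hφ, hφ]
    change residue O₁ z = residue O₁ ⟨a, haO₁⟩ / residue O₁ ⟨b, hbO₁⟩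
    rw [← residue_div O₁ a b haO₁ hbO₁ hb1 hab, ← sub_eq_zero, ← map_sub, residue_eq_zero_iff,
      ValuationSubring.valuation_lt_one_iff]
    exact hz

/-- **The residue chart is a rational function field in two variables.** In the situation of
`residue_eq_residueChart`, every element of the subfield `κ` (`ι : κ → κ(O₁)` injective, being
a ring map out of a field) is a fraction `φ a / φ b` with `φ a, φ b ∈ k[φ x, φ y]`, `φ b ≠ 0`.
[folklore] -/
theorem exists_fraction_residueChart (O O₁ : ValuationSubring K) (hO : O ≤ O₁)
    (A : Subalgebra k K) (hA : A.toSubring ≤ O.toSubring) {κ : Type*} [Field κ] [Algebra k κ]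
    (ι : κ →+* ResidueField O₁) (φ : A →ₐ[k] κ)
    (hφ : ∀ a : A, ι (φ a) = residue O₁ ⟨(a : K), (hA.trans hO) a.2⟩)
    {x y : K} (hx : x ∈ A) (hy : y ∈ A) (hadj : Algebra.adjoin k ({x, y} : Set K) ≤ A)
    (hres : ∀ z ∈ O₁, ∃ a ∈ Algebra.adjoin k ({x, y} : Set K),
      ∃ b ∈ Algebra.adjoin k ({x, y} : Set K),
      O₁.valuation b = 1 ∧ O₁.valuation (z - a / b) < 1) (w : κ) :
    ∃ a ∈ Algebra.adjoin k ({φ ⟨x, hx⟩, φ ⟨y, hy⟩} : Set κ),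
      ∃ b ∈ Algebra.adjoin k ({φ ⟨x, hx⟩, φ ⟨y, hy⟩} : Set κ), b ≠ 0 ∧ w = a / b := by
  obtain ⟨z, hz⟩ := residue_surjective (ι w)
  obtain ⟨a, b, ha, hb, hb0, h⟩ := residue_eq_residueChart O O₁ hO A hA ι φ hφ hadj hres z
  refine ⟨φ a, map_mem_adjoin_pair A φ hx hy a ha, φ b, map_mem_adjoin_pair A φ hx hy b hb,
    hb0, ι.injective ?_⟩
  rw [← hz, h]

end residueChart

/-- **Relative local uniformization of a composite valuation over a rational residue surface**
(Novacoski–Spivakovsky 2014, proof of Thm. 1.1, §3.1, for ONE decomposition `ν = ν₁ ∘ ν₂`).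
Let `k ⊆ K` be fields and `O ≤ O₁` valuation rings of `K`. Assume: `ν₁ = ν_{O₁}` admits
relative local uniformization over `k` (`h₁`); the residue field of `O₁` is generated over `k`
by the residues of `x, y ∈ O` as a rational function field in two variables (`hind`: no nonzero
`P ∈ k[X, Y]` has `ν₁(P(x, y)) > 0`; `hres`: every `z ∈ O₁` is `≡ a / b (mod 𝔪_{O₁})` with
`a, b ∈ k[x, y]`, `ν₁(b) = 0`); and every valuation ring containing `k` of every rational
function field in two variables over `k` admits relative local uniformization (`hLU2`). Then
`O` admits relative local uniformization over `k`. Proof: enlarge the model `R` to `R[x, y]`,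
then Cor. 2.14 (`novacoskiSpivakovsky2014_cor214`, input `h₁`), Cor. 2.17
(`novacoskiSpivakovsky2014_cor217`, input `hLU2` on the residue chart `κ = k(x̄, ȳ)`, which is
all of `κ(O₁)`: `algebraicIndependent_residuePair`, `exists_fraction_residueChart`) and the
final step of §3.1 (`novacoskiSpivakovsky2014_step`).
[cite: NovacoskiSpivakovsky2014, Thm. 1.1 (proof, §3.1)] -/
theorem relLU_of_le_of_purelyTranscendentalResidue (k K : Type) [Field k] [Field K] [Algebra k K]
    (hLU2 : ∀ (κ : Type) [Field κ] [Algebra k κ] (x' y' : κ), AlgebraicIndependent k ![x', y'] →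
      (∀ w : κ, ∃ a ∈ Algebra.adjoin k {x', y'}, ∃ b ∈ Algebra.adjoin k {x', y'}, b ≠ 0 ∧ w = a / b) →
      ∀ W : ValuationSubring κ, (∀ c : k, algebraMap k κ c ∈ W) → RelLocalUniformization k κ W)
    (O O₁ : ValuationSubring K) (hO : O ≤ O₁) (h₁ : RelLocalUniformization k K O₁)
    (x y : K) (hx : x ∈ O) (hy : y ∈ O)
    (hind : ∀ P : MvPolynomial (Fin 2) k, P ≠ 0 →
      O₁.valuation (MvPolynomial.aeval ![x, y] P) = 1)
    (hres : ∀ z ∈ O₁, ∃ a ∈ Algebra.adjoin k ({x, y} : Set K), ∃ b ∈ Algebra.adjoin k ({x, y} : Set K),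
      O₁.valuation b = 1 ∧ O₁.valuation (z - a / b) < 1) :
    RelLocalUniformization k K O := by
  classical
  intro R hR hfrac hRO
  haveI := hfrac
  -- Step 0: enlarge the model to `R' = R[x, y] ⊆ O`
  have hk : ∀ c : k, algebraMap k K c ∈ O := fun c => hRO (R.algebraMap_mem c)
  let Ok : Subalgebra k K := ({ O.toSubring with algebraMap_mem' := hk } : Subalgebra k K)
  let R' : Subalgebra k K := R ⊔ Algebra.adjoin k ({x, y} : Set K)
  have hadjfg : (Algebra.adjoin k ({x, y} : Set K)).FG :=
    Subalgebra.fg_def.mpr ⟨{x, y}, Set.toFinite _, rfl⟩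
  have hR'fg : R'.FG := hR.sup hadjfg
  have hRR' : R ≤ R' := le_sup_left
  have hadjR' : Algebra.adjoin k ({x, y} : Set K) ≤ R' := le_sup_right
  have hR'Ok : R' ≤ Ok := by
    refine sup_le (fun z hz => hRO hz) ?_
    rw [Algebra.adjoin_le_iff]
    intro z hz
    rcases hz with rfl | rfl
    · exact hx
    · exact hy
  have hR'O : R'.toSubring ≤ O.toSubring := fun z hz => hR'Ok hz
  haveI hfrac' : IsFractionRing R' K := isFractionRing_subalgebra_of_le R R' hRR'
  -- Step 1: Cor. 2.14 with the local uniformization `h₁` of `ν₁`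
  obtain ⟨A₁, hA₁, hR'A₁, hA₁fg, hreg₁⟩ :=
    novacoskiSpivakovsky2014_cor214 O O₁ hO R' hR'fg hfrac' hR'O
      (h₁ R' hR'fg hfrac' (hR'O.trans hO))
  haveI hfrac₁ : IsFractionRing A₁ K := isFractionRing_subalgebra_of_le R' A₁ hR'A₁
  have hadjA₁ : Algebra.adjoin k ({x, y} : Set K) ≤ A₁ := hadjR'.trans hR'A₁
  have hxA₁ : x ∈ A₁ := hadjA₁ (Algebra.subset_adjoin (Set.mem_insert x {y}))
  have hyA₁ : y ∈ A₁ :=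
    hadjA₁ (Algebra.subset_adjoin (Set.mem_insert_of_mem x (Set.mem_singleton y)))
  -- Step 2: the input of Cor. 2.17 from `hLU2` on the residue chart `κ = k(x̄, ȳ)`
  have ih₂' : ∀ (κ : Type) [Field κ] [Algebra k κ] (ι : κ →+* ResidueField O₁) (φ : A₁ →ₐ[k] κ),
      (∀ a : A₁, ι (φ a) = residue O₁ ⟨(a : K), (hA₁.trans hO) a.2⟩) →
      IsFractionRing φ.range κ →
      ∃ (B : Subalgebra k κ)
        (hB : B.toSubring ≤ ((residueValuationSubring O O₁ hO).comap ι).toSubring),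
        φ.range ≤ B ∧ B.FG ∧
        IsRegularLocalRing (Localization.AtPrime
          ((maximalIdeal ((residueValuationSubring O O₁ hO).comap ι)).comap
            (Subring.inclusion hB))) := by
    intro κ _ _ ι φ hφ hfr
    have hind' : AlgebraicIndependent k ![φ ⟨x, hxA₁⟩, φ ⟨y, hyA₁⟩] :=
      algebraicIndependent_residuePair O₁ A₁ (hA₁.trans hO) ι φ hφ hxA₁ hyA₁ hind
    have hgen' := exists_fraction_residueChart O O₁ hO A₁ hA₁ ι φ hφ hxA₁ hyA₁ hadjA₁ hres
    have hk' : ∀ c : k, algebraMap k κ c ∈ (residueValuationSubring O O₁ hO).comap ι := by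
      intro c
      rw [ValuationSubring.mem_comap, ← φ.commutes c, hφ]
      exact (residue_mem_residueValuationSubring_iff O O₁ hO _).mpr (hA₁ (algebraMap k A₁ c).2)
    have hLU : RelLocalUniformization k κ ((residueValuationSubring O O₁ hO).comap ι) :=
      hLU2 κ (φ ⟨x, hxA₁⟩) (φ ⟨y, hyA₁⟩) hind' hgen' _ hk'
    have hfg : φ.range.FG := by
      have h := ((Subalgebra.fg_top A₁).mpr hA₁fg).map φ
      rwa [Algebra.map_top] at h
    have hle : φ.range.toSubring ≤ ((residueValuationSubring O O₁ hO).comap ι).toSubring := by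
      intro z hz
      obtain ⟨a, rfl⟩ := (AlgHom.mem_range φ).mp (show z ∈ φ.range from hz)
      change φ a ∈ (residueValuationSubring O O₁ hO).comap ι
      rw [ValuationSubring.mem_comap, hφ]
      exact (residue_mem_residueValuationSubring_iff O O₁ hO _).mpr (hA₁ a.2)
    exact hLU φ.range hfg hfr hle
  obtain ⟨A₂, hA₂, hA₁₂, hA₂fg, hreg₂, hreg₂'⟩ :=
    novacoskiSpivakovsky2014_cor217 O O₁ hO A₁ hA₁ hA₁fg hfrac₁ hreg₁ ih₂'
  haveI hfrac₂ : IsFractionRing A₂ K := isFractionRing_subalgebra_of_le A₁ A₂ hA₁₂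
  -- Step 3: the final step of §3.1
  obtain ⟨A₃, hA₃, hA₂₃, hA₃fg, hreg₃⟩ :=
    novacoskiSpivakovsky2014_step O O₁ hO A₂ hA₂ hA₂fg hfrac₂ hreg₂ hreg₂'
  exact ⟨A₃, hA₃, (hRR'.trans hR'A₁).trans (hA₁₂.trans hA₂₃), hA₃fg, hreg₃⟩

end Summit.ResolutionOfSingularities.ResolutionOfSingularities.Theorems.ValuativeSmoothing
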